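import Summits.CriticalPhenomena.PercolationContinuityZ3.Theorems.FK.UniquenessOfNonPercolationTheta
import HarnessLib

/-!
# FK-continuity cell, FO-10a: `q = 2`, `d ≥ 3` — the critical FK–Ising infinite-volume measure on `ℤ^d` is
# UNIQUE, `φ⁰_{p_c(2),2} = φ¹_{p_c(2),2}`, and its edge density is continuous at `p_c(2)`
# (Grimmett 2006, Conj. (5.34)(ii) at `q = 2` via Aizenman–Duminil-Copin–Sidoravicius 2015)

Registered R73 (cell INBOX l.5522, 2026-08-23); registry row FO-10a-g335; label NPC-D (coordinator fk-4 g152).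
Cell `fk-continuity` (bschramm), row FO-10a; support file for the FK-continuity transplant
(`--supports stmt-CriticalPhenomena-4575`); builds on p205010 (kernel theorem, internal audit signed;
external expert review pending). Pure proofs; no definitions, no named facts, no sorries.

The `q = 2` instance of `UniquenessOfNonPercolationTheta.lean`: the tree's theorem
`thetaWired_rcCriticalProb_two_eq_zero` (`θ¹(p_c(2), 2) = 0` on `ℤ^d`, `d ≥ 3` — Aizenman–Duminil-Copin–
Sidoravicius 2015, Thm. 1.2 / Cor. 1.5(1), through Grimmett's (5.19) `θ¹ = m*` and `p_c(2) = 1 - e^{-2β_c}`;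
FO-01's `wired_two`) fed into `rcLimit_false_eq_rcLimit_true_of_fkContinuityWired` gives

* `rcLimit_false_eq_rcLimit_true_rcCriticalProb_two` — **`φ⁰_{p_c(2),2} = φ¹_{p_c(2),2}` for `d ≥ 3`**: a
  UNIQUE critical random-cluster measure for the FK–Ising model (Grimmett 2006, Conj. (5.34)(ii) decided at
  `q = 2`, `d ≥ 3`; the random-cluster form of "continuity of the magnetisation ⇒ uniqueness of the critical
  Gibbs state", ADS 2015); the same at the Edwards–Sokal parameter `p = 1 - e^{-2β_c(d)}`
  (`rcLimit_false_eq_rcLimit_true_fkIsingParam_criticalBeta_two`);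
* `fkGibbs_rcCriticalProb_two_iff` — the critical sandwich class `FKGibbs d (p_c(2)) 2` is the singleton
  `{φ⁰_{p_c(2),2}}`, none of whose members percolates (`FKGibbs.eq_rcLimit_false_and_percolatesAt_rcCriticalProb_two`);
* `freeEdgeDensity_eq_wiredEdgeDensity_rcCriticalProb_two` — `h⁰(p_c(2),2) = h¹(p_c(2),2)`: no jump of the
  edge (energy) density of the critical FK–Ising model, `d ≥ 3` (`p_c(2) ∉ 𝒟_2`, Thm. (4.63)).

HONEST FRAMING: a COROLLARY of the in-tree ADS chain (`thetaWired_rcCriticalProb_two_eq_zero`), flagged for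
FO-13 non-circularity exactly like `GibbsThetaSandwich.real_percolatesAt_rcCriticalProb_two_eq_zero`: it is not
upstream of any `T_F(2)` / `T_W(2)` statement and discharges no binder of the cell; for `q ∈ (1,2)` nothing is
claimed. SECOND ROUTE OF RECORD (spin side, `q = 2` only): the same equality `φ⁰_{p_c(2),2} = φ¹_{p_c(2),2}` also
follows from the tree's Lebowitz criterion `nn_freeCorr_eq_plusCorr_of_leftContinuous_magnetization`
(`LebowitzMagnetizationCriterion.lean`; `m*` is left-continuous at `β_c` since it vanishes on `[0, β_c]`, ADS) through
the Edwards–Sokal dictionary `freeEdgeDensity_eq_wiredEdgeDensity_of_nn_freeCorr_eq_plusCorr` and FO-07b's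
Thm. (4.63) `rcLimit_false_eq_rcLimit_true_of_edgeDensity_eq`; the route here is the boundary-condition one
(`θ¹(p_c(2),2) = 0` ⇒ uniqueness, valid verbatim for every `q ≥ 1` where `θ¹(p_c(q),q) = 0` is known).

## References

* M. Aizenman, H. Duminil-Copin, V. Sidoravicius, Comm. Math. Phys. 334 (2015) 719–742, Thm. 1.2, Cor. 1.5(1)
  (continuity of the magnetisation, `d ≥ 3`). [AizenmanDuminilCopinSidoraviciusCMP2015]
* G. Grimmett, *The Random-Cluster Model*, Springer 2006: Thm. (4.63), Thm. (5.17) eq. (5.19), Thm. (5.33)(a),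
  Conj. (5.34)(ii) [PDF pp. 89, 102, 107]. [Grimmett2006]
-/

noncomputable section

open MeasureTheory Set Filter
open scoped Topology ENNReal

namespace Summit.CriticalPhenomena.PercolationContinuityZ3.Theorems.FK

open Literature.Probability.Percolation Literature.Probability.LatticeModels
open Literature.Barriers.CriticalPhenomena

variable {d : ℕ} {P : Measure (BondConfig (Site d))}

/-- **The critical FK–Ising measure on `ℤ^d`, `d ≥ 3`, is unique: `φ⁰_{p_c(2),2} = φ¹_{p_c(2),2}`**
(Conj. (5.34)(ii) at `q = 2` via `θ¹(p_c(2),2) = 0`, ADS 2015). [cite: Grimmett2006, Conj. (5.34)(ii) with Thm. (5.33)(a)] [cite: AizenmanDuminilCopinSidoraviciusCMP2015, Thm. 1.2 with Cor. 1.5 (1)] -/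
theorem rcLimit_false_eq_rcLimit_true_rcCriticalProb_two (hd : 3 ≤ d) :
    rcLimit d false (rcCriticalProb d 2) 2 = rcLimit d true (rcCriticalProb d 2) 2 :=
  rcLimit_false_eq_rcLimit_true_of_fkContinuityWired (by norm_num) (wired_two hd)

/-- The same at the Edwards–Sokal parameter of the critical Ising model: `φ⁰_{p,2} = φ¹_{p,2}` at
`p = 1 - e^{-2β_c(d)}`, `d ≥ 3`. [cite: Grimmett2006, (5.2) with Thm. (5.17) eq. (5.19); Conj. (5.34)(ii)] [cite: AizenmanDuminilCopinSidoraviciusCMP2015, Thm. 1.2 with Cor. 1.5 (1)] -/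
theorem rcLimit_false_eq_rcLimit_true_fkIsingParam_criticalBeta_two (hd : 3 ≤ d) :
    rcLimit d false (fkIsingParam (criticalBeta d)) 2 = rcLimit d true (fkIsingParam (criticalBeta d)) 2 := by
  rw [← rcCriticalProb_two_eq_fkIsingParam_criticalBeta (by omega)]
  exact rcLimit_false_eq_rcLimit_true_rcCriticalProb_two hd

/-- **Uniqueness of the critical FK–Ising state, `d ≥ 3`**: the sandwich class at `(p_c(2), 2)` is the
singleton `{φ⁰_{p_c(2),2}}`. [cite: Grimmett2006, Conj. (5.34)(ii) with Thm. (5.33)(a) and (4.36)] [cite: AizenmanDuminilCopinSidoraviciusCMP2015, Thm. 1.2 with Cor. 1.5 (1)] -/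
theorem fkGibbs_rcCriticalProb_two_iff (hd : 3 ≤ d) :
    FKGibbs d (rcCriticalProb d 2) 2 P ↔ P = rcLimit d false (rcCriticalProb d 2) 2 :=
  fkGibbs_iff_eq_rcLimit_false_of_fkContinuityWired (by norm_num) (wired_two hd)

/-- Every critical FK–Ising sandwich measure (`d ≥ 3`) equals `φ⁰_{p_c(2),2}` and has almost surely no
infinite cluster. [cite: Grimmett2006, Conj. (5.34)(ii) with Thm. (5.33)(a) and (4.21)] [cite: AizenmanDuminilCopinSidoraviciusCMP2015, Thm. 1.2 with Cor. 1.5 (1)] -/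
theorem FKGibbs.eq_rcLimit_false_and_percolatesAt_rcCriticalProb_two (hd : 3 ≤ d)
    (hP : FKGibbs d (rcCriticalProb d 2) 2 P) :
    P = rcLimit d false (rcCriticalProb d 2) 2 ∧ ∀ x : Site d, P.real (percolatesAt x) = 0 :=
  hP.eq_rcLimit_false_and_percolatesAt_of_fkContinuityWired (by norm_num) (wired_two hd)

/-- **No jump of the edge density of the critical FK–Ising model, `d ≥ 3`**: `h⁰(p_c(2),2) = h¹(p_c(2),2)`
at every lattice edge (`p_c(2) ∉ 𝒟_2`). [cite: Grimmett2006, Thm. (4.63) with Conj. (5.34)(ii)] [cite: AizenmanDuminilCopinSidoraviciusCMP2015, Thm. 1.2 with Cor. 1.5 (1)] -/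
theorem freeEdgeDensity_eq_wiredEdgeDensity_rcCriticalProb_two (hd : 3 ≤ d) {e : Sym2 (Site d)}
    (he : e ∈ (zdGraph d).edgeSet) :
    freeEdgeDensity d (rcCriticalProb d 2) 2 e = wiredEdgeDensity d (rcCriticalProb d 2) 2 e :=
  freeEdgeDensity_eq_wiredEdgeDensity_of_fkContinuityWired (by norm_num) (wired_two hd) he

/-- On `ℤ³`: the critical FK–Ising infinite-volume measure is unique, `φ⁰_{p_c(2),2} = φ¹_{p_c(2),2}`.
[cite: Grimmett2006, Conj. (5.34)(ii) with Thm. (5.33)(a)] [cite: AizenmanDuminilCopinSidoraviciusCMP2015, Thm. 1.2 with Cor. 1.5 (1)] -/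
theorem rcLimit_false_eq_rcLimit_true_rcCriticalProb_two_z3 :
    rcLimit 3 false (rcCriticalProb 3 2) 2 = rcLimit 3 true (rcCriticalProb 3 2) 2 :=
  rcLimit_false_eq_rcLimit_true_rcCriticalProb_two le_rfl

end Summit.CriticalPhenomena.PercolationContinuityZ3.Theorems.FK

end
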